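import Mathlib
import Literature.NumberTheory.LFunctions.Zhang2022.AppendixAEulerProductU004
import Literature.NumberTheory.LFunctions.Zhang2022.Section7SjPolylog
import Literature.NumberTheory.LFunctions.Zhang2022.Section10RangeToolkit
import Literature.NumberTheory.Sieve.ShiuDivisorClass
import HarnessLib

/-!
# Zhang (2022) §7: the short-interval absolute mean of `ξ₀ⱼ(n;d,r)` with NO logarithmic loss

Topic `Literature/NumberTheory/LFunctions/Zhang2022` (Landau–Siegel audit tree; verdict-neutral).
Y. Zhang, *Discrete mean estimates and the Landau–Siegel zero*, arXiv:2211.02515v1 (2022)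
[Zhang2022LandauSiegel], §7 p. 33 (the arithmetic function `ξ₀ⱼ(n;d,r)` of Proposition 7.1) and
App. A pp. 102–103 (its values at prime powers, Cases 1–3) — **an unrefereed manuscript under
adjudication; nothing here asserts or denies its Theorems 1–2.** This file is a TOOL over the
manuscript's object `Skeleton.xiZero`; it makes no claim of the manuscript.

Several unprinted steps of §§11–12 ("by (8.25), (8.26)", "by (4.2) and (4.3)": the window mean
squares `Step11u019/J2`, the `S_j`-smallness behind (12.6)/(12.8), the `g`-unsmoothing of
§12.u024) need SHORT sums `Σ_{x<n≤x+y} |ξ₀ⱼ(n;d,r)|` with `y/x` as small as `𝓛⁻¹⁰…𝓛⁻¹⁵` bounded by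
`≪ y` — with NO power of `log x` (each `log x ≍ 𝓛⁹` is fatal there). The tree's multiplicative
majorants `gMaj` (prime value `≈ 3`) and `gC` (prime value `≈ 5`) lose `(log x)²`, `(log x)⁴` in
Shiu's theorem. The point of this file: the TRUE prime values have effective size ONE —

* `norm_xiZero_prime_le_sharp` — for every prime `q` and `d, r ≥ 1`,
  `‖ξ₀ⱼ(q;d,r)‖ ≤ 1 + [q ∣ r] + 7·B·log q + M₇/q`, `B = |b₁|+|b₂|+|b₃|` (`XiZeroMajorant.Bsum`),
  `M₇ = 189·S₃ + 26` (`S₃ = LogEulerProduct.tailConst 3`). At `q ∤ dr` (App. A Case 1,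
  `Lemma83.xiZero_prime_pow_of_coprime`) `ξ₀ⱼ(q) = λ₀ⱼ(q)(κ̃₀ⱼ(q;dr) − q^{1−β_j}/(q−1))` and the
  `k = 1` / `k = q` terms CANCEL: `κ(q) − q^{−β_j} = Σ_{i≠j} q^{−β_i} − 1` has modulus
  `≤ 1 + B log q` (`MeanSquareMajorant.kappa_apply_prime`, `norm_powI_sub_one_le`); Cases 2–3
  (`q ∣ r`: `ξ₀ⱼ(q) = κ(q)`, modulus `≤ 2 + B log q`; `q ∣ d`: `≤ 1 + B log q + 2/q`).
* `euler_exponent_dvd_le`, `shiu_divisor_class_dvd` — Shiu's theorem for the divisor class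
  (tree `Sieve.ShiuDivisorClass.shiu_divisor_class`, constants depending on `a, d, C₅` only) with
  the prime bound allowed to exceed `a + K log p + M/p` by `1` on the primes dividing a fixed `r`;
  the price is the factor `exp(Σ_{p∣r} 1/p) ≤ r/φ(r)` (`exp_sum_inv_primeFactors_le`).
* `xiZero_shortInterval` — **the engine**: absolute `C, x₀` with
  `Σ_{x<n≤x+y} ‖ξ₀ⱼ(n;d,r)‖ ≤ C·e^{7B·log(4x)}·(r/φ(r))·y` for all `c′, D, j, d, r ≥ 1`, `x ≥ x₀`,
  `x^{1/4} ≤ y ≤ x` (Shiu at exponent `a = 1`: the `(log x)¹/log x` cancels). For `D` large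
  `B ≤ 9π𝓛⁻⁹` (`three_le_ell_and_Bsum_le`), so `e^{7B log(4x)} ≤ e^{64π}` up to `x ≤ P = e^{𝓛⁹}`.

0 new definitions; standard axioms.

## References

* Y. Zhang, arXiv:2211.02515v1 (2022), §7 p. 33; App. A pp. 102–103.
  [cite: Zhang2022LandauSiegel, §7 p. 33; App. A pp. 102–103]
* P. Shiu, *A Brun–Titchmarsh theorem for multiplicative functions*, J. reine angew. Math. 313
  (1980) 161–170, Theorem 1. [cite: Shiu1980, Theorem 1]
* G. H. Hardy, E. M. Wright, *An Introduction to the Theory of Numbers*, Thms 315, 425, 427.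
  [cite: HardyWright2008, Theorems 315, 425, 427]
-/

noncomputable section

open Finset Real

namespace Literature.NumberTheory.LFunctions.Zhang2022.XiZeroMajorant

open Literature.NumberTheory.Sieve
open Literature.NumberTheory.LFunctions.Zhang2022.MeanSquareMajorant (powI powI_apply_of_ne_zero
  norm_powI_of_pos norm_powI_sub_one_le kappa_apply_prime norm_kappa_prime_le)

/-! ### Part 1. Shiu for the divisor class with exceptional primes dividing a fixed `r` -/

/-- `C₅(ν+1)^d ≤ (max(C₅,1)·2^d)^ν` for `ν ≥ 1` (`ν + 1 ≤ 2^ν`). [folklore] -/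
private theorem prime_pow_bound_le_pow' {C₅ : ℝ} (d : ℕ) {ν : ℕ} (hν : 1 ≤ ν) :
    C₅ * ((ν : ℝ) + 1) ^ d ≤ (max C₅ 1 * (2 : ℝ) ^ d) ^ ν := by
  have hA : 1 ≤ max C₅ 1 := le_max_right _ _
  have h1 : ((ν : ℝ) + 1) ≤ (2 : ℝ) ^ ν := by
    have := Nat.lt_two_pow_self (n := ν)
    exact_mod_cast this
  have h2 : ((ν : ℝ) + 1) ^ d ≤ ((2 : ℝ) ^ d) ^ ν := by
    calc ((ν : ℝ) + 1) ^ d ≤ ((2 : ℝ) ^ ν) ^ d := pow_le_pow_left₀ (by positivity) h1 d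
      _ = ((2 : ℝ) ^ d) ^ ν := by rw [← pow_mul, ← pow_mul, mul_comm]
  have h3 : C₅ ≤ (max C₅ 1) ^ ν :=
    le_trans (le_max_left _ _) (le_self_pow₀ hA (by omega))
  calc C₅ * ((ν : ℝ) + 1) ^ d ≤ (max C₅ 1) ^ ν * ((2 : ℝ) ^ d) ^ ν :=
        mul_le_mul h3 h2 (by positivity) (le_trans zero_le_one (one_le_pow₀ hA))
    _ = (max C₅ 1 * (2 : ℝ) ^ d) ^ ν := by rw [mul_pow]

/-- **`exp(Σ_{p∣r} 1/p) ≤ r/φ(r)`** (`r ≥ 1`): `e^{1/p} ≤ (1 − 1/p)⁻¹ = p/(p−1)` and Euler's product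
`r/φ(r) = ∏_{p∣r} p/(p−1)`. [cite: HardyWright2008, Theorem 315] -/
theorem exp_sum_inv_primeFactors_le {r : ℕ} (hr : r ≠ 0) :
    Real.exp (∑ p ∈ r.primeFactors, (1 : ℝ) / p) ≤ (r : ℝ) / r.totient := by
  rw [Skeleton.self_div_totient_eq_prod hr, Real.exp_sum]
  refine Finset.prod_le_prod (fun p _ => (Real.exp_pos _).le) fun p hp => ?_
  have h2 : (2 : ℝ) ≤ p := by exact_mod_cast (Nat.prime_of_mem_primeFactors hp).two_le
  have hp0 : (0 : ℝ) < p := by linarith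
  have hpos : 0 < 1 - 1 / (p : ℝ) := by
    rw [sub_pos, div_lt_one hp0]; linarith
  have h1 : 1 - 1 / (p : ℝ) ≤ Real.exp (-(1 / (p : ℝ))) := by
    have := Real.add_one_le_exp (-(1 / (p : ℝ))); linarith
  calc Real.exp (1 / (p : ℝ)) = (Real.exp (-(1 / (p : ℝ))))⁻¹ := by
        rw [Real.exp_neg, inv_inv]
    _ ≤ (1 - 1 / (p : ℝ))⁻¹ := inv_anti₀ hpos h1
    _ = (p : ℝ) / (p - 1) := by field_simp

/-- **The Euler exponent with exceptional primes.** If `f ≥ 0` and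
`f(p) ≤ a + [p ∣ r] + K log p + M/p` for the primes `p ≤ x` (`K, M ≥ 0`, `x ≥ 2`, `r ≥ 1`), then
`∑_{p ≤ x, p ∤ 1} f(p)/p ≤ a(log log x + 4) + K(log x + log 4) + M + Σ_{p∣r} 1/p` (the tree's
`ShiuDivisorClass.euler_exponent_le` plus `Σ_{p≤x, p∣r} 1/p ≤ Σ_{p∣r} 1/p`).
[cite: HardyWright2008, Theorems 425, 427] -/
theorem euler_exponent_dvd_le {f : ℕ → ℝ} (hf0 : ∀ n, 0 ≤ f n) {a : ℕ} {K M : ℝ} (hK : 0 ≤ K)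
    (hM : 0 ≤ M) {r : ℕ} (hr : r ≠ 0) {x : ℝ} (hx : 2 ≤ x)
    (hfp : ∀ p : ℕ, p.Prime → (p : ℝ) ≤ x →
      f p ≤ a + (if p ∣ r then (1 : ℝ) else 0) + K * Real.log p + M / p) :
    ∑ p ∈ (Finset.Icc 1 ⌊x⌋₊).filter (fun p : ℕ => p.Prime ∧ ¬p ∣ 1), f p / p ≤
      a * (Real.log (Real.log x) + 4) + K * (Real.log x + Real.log 4) + M +
        ∑ p ∈ r.primeFactors, (1 : ℝ) / p := by
  classical
  -- split `f = g + e` on the primes `p ≤ x`, with `g(p) ≤ a + K log p + M/p` and `e(p) ≤ [p ∣ r]`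
  set g : ℕ → ℝ := fun p => min (f p) (a + K * Real.log p + M / p) with hg
  set e : ℕ → ℝ := fun p => f p - g p with he
  have hg0 : ∀ n, 0 ≤ g n := by
    intro n
    rcases Nat.eq_zero_or_pos n with rfl | hn
    · simp only [hg, Nat.cast_zero, Real.log_zero, mul_zero, add_zero, div_zero]
      exact le_min (hf0 0) (Nat.cast_nonneg a)
    · have hn' : (1 : ℝ) ≤ n := by exact_mod_cast hn
      refine le_min (hf0 n) ?_
      have : 0 ≤ Real.log n := Real.log_nonneg hn'
      positivity
  have hgp : ∀ p : ℕ, p.Prime → (p : ℝ) ≤ x → g p ≤ a + K * Real.log p + M / p :=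
    fun p _ _ => min_le_right _ _
  have hep : ∀ p : ℕ, p.Prime → (p : ℝ) ≤ x → e p ≤ if p ∣ r then (1 : ℝ) else 0 := by
    intro p hp hpx
    simp only [he, hg]
    have h := hfp p hp hpx
    rcases le_total (f p) (a + K * Real.log p + M / p) with h1 | h1
    · rw [min_eq_left h1, sub_self]; split_ifs <;> norm_num
    · rw [min_eq_right h1]; linarith
  have hsplit : ∀ p, f p / p = g p / p + e p / p := fun p => by simp only [he]; ring
  rw [Finset.sum_congr rfl (fun p _ => hsplit p), Finset.sum_add_distrib]
  have hG := ShiuDivisorClass.euler_exponent_le (a := a) hg0 hK hM hx hgp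
  -- the exceptional part
  have hE : ∑ p ∈ (Finset.Icc 1 ⌊x⌋₊).filter (fun p : ℕ => p.Prime ∧ ¬p ∣ 1), e p / p ≤
      ∑ p ∈ r.primeFactors, (1 : ℝ) / p := by
    have hx0 : 0 ≤ x := by linarith
    calc ∑ p ∈ (Finset.Icc 1 ⌊x⌋₊).filter (fun p : ℕ => p.Prime ∧ ¬p ∣ 1), e p / p
        ≤ ∑ p ∈ (Finset.Icc 1 ⌊x⌋₊).filter (fun p : ℕ => p.Prime ∧ ¬p ∣ 1),
            (if p ∣ r then (1 : ℝ) / p else 0) := by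
          refine Finset.sum_le_sum fun p hp => ?_
          obtain ⟨hpI, hpp, -⟩ := Finset.mem_filter.mp hp
          have hpx : (p : ℝ) ≤ x := le_trans (by exact_mod_cast (Finset.mem_Icc.mp hpI).2)
            (Nat.floor_le hx0)
          have hp0 : (0 : ℝ) < p := by exact_mod_cast hpp.pos
          have h := div_le_div_of_nonneg_right (hep p hpp hpx) hp0.le
          refine h.trans (le_of_eq ?_)
          split_ifs <;> simp
      _ = ∑ p ∈ ((Finset.Icc 1 ⌊x⌋₊).filter (fun p : ℕ => p.Prime ∧ ¬p ∣ 1)).filter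
            (fun p => p ∣ r), (1 : ℝ) / p := (Finset.sum_filter (· ∣ r) _).symm
      _ ≤ ∑ p ∈ r.primeFactors, (1 : ℝ) / p := by
          refine Finset.sum_le_sum_of_subset_of_nonneg ?_ (fun p _ _ => by positivity)
          intro p hp
          simp only [Finset.mem_filter] at hp
          exact Nat.mem_primeFactors.mpr ⟨hp.1.2.1, hp.2, hr⟩
  linarith

/-- **Shiu's theorem for the divisor class with exceptional primes** (Shiu 1980, Theorem 1, `q = 1`;
constants depending on `a, d, C₅` ONLY). For `a d : ℕ` and a real `C₅` there are `C ≥ 0`, `x₀ ≥ 2`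
such that for every `f ≥ 0` with `f(mn) = f(m)f(n)` (`(m,n) = 1`) and `f(p^ν) ≤ C₅(ν+1)^d` (`ν ≥ 1`),
every `r ≥ 1`, all `K, M ≥ 0`, all `x ≥ x₀`, `x^{1/4} ≤ y ≤ x` such that
`f(p) ≤ a + [p ∣ r] + K log p + M/p` for the primes `p ≤ x`:
`∑_{x < n ≤ x+y} f(n) ≤ C · exp(K log(4x) + M) · (r/φ(r)) · y · (log x)^a / log x`.
[cite: Shiu1980, Theorem 1] -/
theorem shiu_divisor_class_dvd (a d : ℕ) (C₅ : ℝ) :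
    ∃ C x₀ : ℝ, 0 ≤ C ∧ 2 ≤ x₀ ∧ ∀ f : ℕ → ℝ, (∀ n, 0 ≤ f n) →
      (∀ m n : ℕ, m.Coprime n → f (m * n) = f m * f n) →
      (∀ p ν : ℕ, p.Prime → 1 ≤ ν → f (p ^ ν) ≤ C₅ * ((ν : ℝ) + 1) ^ d) →
      ∀ r : ℕ, r ≠ 0 → ∀ K M : ℝ, 0 ≤ K → 0 ≤ M → ∀ x y : ℝ, x₀ ≤ x → x ^ (1 / 4 : ℝ) ≤ y → y ≤ x →
        (∀ p : ℕ, p.Prime → (p : ℝ) ≤ x →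
            f p ≤ a + (if p ∣ r then (1 : ℝ) else 0) + K * Real.log p + M / p) →
        ∑ n ∈ (Finset.Icc 1 ⌊x + y⌋₊).filter (fun n : ℕ => x < n), f n ≤
          C * Real.exp (K * Real.log (4 * x) + M) * ((r : ℝ) / r.totient) * y * Real.log x ^ a /
            Real.log x := by
  obtain ⟨A₂, hA₂⟩ := ShiuDivisorClass.exists_rpow_majorant d C₅
  obtain ⟨C, x₀, hC0, hS⟩ := shiu_uniform (A₁ := max C₅ 1 * (2 : ℝ) ^ d) (by positivity) A₂
    (ε := 1 / 4) (θ := 1 / 4) (by norm_num) (by norm_num) (by norm_num) (by norm_num)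
  refine ⟨C * Real.exp (4 * a), max x₀ 2, by positivity, le_max_right _ _, ?_⟩
  intro f hf0 hmul hpow r hr K M hK hM x y hx hxy hyx hfp
  have hx2 : 2 ≤ x := le_trans (le_max_right _ _) hx
  have hx1 : 1 < x := by linarith
  have hx0 : 0 < x := by linarith
  have hlogx : 0 < Real.log x := Real.log_pos hx1
  have hpl : ∀ p l : ℕ, p.Prime → 1 ≤ l → f (p ^ l) ≤ (max C₅ 1 * (2 : ℝ) ^ d) ^ l :=
    fun p l hp hl => (hpow p l hp hl).trans (prime_pow_bound_le_pow' d hl)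
  have hmaj : ∀ δ : ℝ, 0 < δ → ∀ n : ℕ, 1 ≤ n → f n ≤ A₂ δ * (n : ℝ) ^ δ :=
    fun δ hδ n hn => hA₂ f hf0 hmul hpow δ hδ n hn
  -- Shiu with `q = 1`, residue `0`
  have hq : ((1 : ℕ) : ℝ) < y ^ (1 - 1 / 4 : ℝ) := by
    rw [Nat.cast_one]
    have hy1 : 1 < y := by
      have : (1 : ℝ) < x ^ (1 / 4 : ℝ) := Real.one_lt_rpow hx1 (by norm_num)
      linarith
    exact Real.one_lt_rpow hy1 (by norm_num)
  have h := hS f hf0 hmul hpl hmaj x y (le_trans (le_max_left _ _) hx) hxy hyx 1 le_rfl hq 0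
    (Nat.coprime_one_right 0)
  have hset : (Finset.Icc 1 ⌊x + y⌋₊).filter
      (fun n : ℕ => x < n ∧ (n : ZMod 1) = ((0 : ℕ) : ZMod 1)) =
      (Finset.Icc 1 ⌊x + y⌋₊).filter (fun n : ℕ => x < n) := by
    refine Finset.filter_congr fun n _ => ?_
    simp [Subsingleton.elim (n : ZMod 1) 0]
  rw [hset, Nat.totient_one, Nat.cast_one, one_mul] at h
  refine h.trans ?_
  have hy0 : 0 ≤ y := le_trans (Real.rpow_nonneg (by linarith) _) hxy
  -- the Euler exponent
  have hexp0 := euler_exponent_dvd_le (a := a) hf0 hK hM hr hx2 hfp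
  have h4x : Real.log (4 * x) = Real.log x + Real.log 4 := by
    rw [Real.log_mul (by norm_num) hx0.ne']; ring
  have hexp : Real.exp (∑ p ∈ (Finset.Icc 1 ⌊x⌋₊).filter (fun p : ℕ => p.Prime ∧ ¬p ∣ 1), f p / p)
      ≤ Real.exp (4 * a) * Real.log x ^ a * Real.exp (K * Real.log (4 * x) + M) *
          ((r : ℝ) / r.totient) := by
    calc Real.exp (∑ p ∈ (Finset.Icc 1 ⌊x⌋₊).filter (fun p : ℕ => p.Prime ∧ ¬p ∣ 1), f p / p)
        ≤ Real.exp (a * (Real.log (Real.log x) + 4) + K * (Real.log x + Real.log 4) + M +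
            ∑ p ∈ r.primeFactors, (1 : ℝ) / p) := Real.exp_le_exp.mpr hexp0
      _ = Real.exp (4 * a) * Real.log x ^ a * Real.exp (K * Real.log (4 * x) + M) *
            Real.exp (∑ p ∈ r.primeFactors, (1 : ℝ) / p) := by
          rw [show (a : ℝ) * (Real.log (Real.log x) + 4) + K * (Real.log x + Real.log 4) + M +
              ∑ p ∈ r.primeFactors, (1 : ℝ) / p =
              4 * a + a * Real.log (Real.log x) + (K * Real.log (4 * x) + M) +
              ∑ p ∈ r.primeFactors, (1 : ℝ) / p by rw [h4x]; ring,
            Real.exp_add, Real.exp_add, Real.exp_add, ← Real.log_rpow hlogx,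
            Real.exp_log (by positivity), Real.rpow_natCast]
      _ ≤ _ := mul_le_mul_of_nonneg_left (exp_sum_inv_primeFactors_le hr) (by positivity)
  calc C * y / Real.log x * Real.exp (∑ p ∈ (Finset.Icc 1 ⌊x⌋₊).filter
          (fun p : ℕ => p.Prime ∧ ¬p ∣ 1), f p / p)
      ≤ C * y / Real.log x * (Real.exp (4 * a) * Real.log x ^ a *
          Real.exp (K * Real.log (4 * x) + M) * ((r : ℝ) / r.totient)) :=
        mul_le_mul_of_nonneg_left hexp (by positivity)
    _ = C * Real.exp (4 * a) * Real.exp (K * Real.log (4 * x) + M) * ((r : ℝ) / r.totient) * y *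
          Real.log x ^ a / Real.log x := by
        field_simp

/-! ### Part 2. The sharp bound for `ξ₀ⱼ(q;d,r)` at a prime `q` -/

variable (c' : ℝ) (D : ℕ) (j : ℕ)

/-- `‖q^{−ib} + q^{−ib′} − 1‖ ≤ 1 + |b′| log q` for `q ≥ 1` (one unimodular term, one term within
`|b′| log q` of `1`). [folklore] -/
private theorem norm_powI_add_powI_sub_one_le (b b' : ℝ) {q : ℕ} (hq : 0 < q) :
    ‖powI b q + powI b' q - 1‖ ≤ 1 + |b'| * Real.log q := by
  calc ‖powI b q + powI b' q - 1‖ = ‖powI b q + (powI b' q - 1)‖ := by ring_nf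
    _ ≤ ‖powI b q‖ + ‖powI b' q - 1‖ := norm_add_le _ _
    _ ≤ 1 + |b'| * Real.log q := by
        rw [norm_powI_of_pos b hq]
        have := norm_powI_sub_one_le b' hq
        linarith

/-- **The `k = 1` / `k = q` cancellation at a prime**: `‖κ(q) − q^{−β_j}‖ ≤ 1 + B log q`, where
`κ(q) = q^{−β₁} + q^{−β₂} + q^{−β₃} − 1` (`MeanSquareMajorant.kappa_apply_prime`) and `β_j` is one
of `β₁, β₂, β₃` (`β₄ = β₁`, `β₅ = β₂`): the difference is `Σ_{i≠j} q^{−β_i} − 1`.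
[cite: Zhang2022LandauSiegel, §7 p. 33; App. A p. 102] -/
theorem norm_kappaZ_sub_cpow_le {q : ℕ} (hq : q.Prime) :
    ‖Skeleton.kappaZ c' D q - (q : ℂ) ^ (-Skeleton.betaJ c' D j)‖ ≤ 1 + Bsum c' D * Real.log q := by
  have hq0 : 0 < q := hq.pos
  have hlog : 0 ≤ Real.log q := Real.log_nonneg (by exact_mod_cast hq.one_lt.le)
  have hκ : Skeleton.kappaZ c' D q = powI (Skeleton.b1 c' D) q + powI (Skeleton.b2 c' D) q +
      powI (Skeleton.b3 c' D) q - 1 := by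
    rw [Skeleton.kappaZ, kappa_apply_prime _ _ _ hq]
  have hβ : (q : ℂ) ^ (-Skeleton.betaJ c' D j) = powI (bJ c' D j) q := by
    rw [powI_apply_of_ne_zero _ hq.ne_zero, betaJ_eq]
  rw [hκ, hβ]
  have hB1 : |Skeleton.b1 c' D| ≤ Bsum c' D := by
    unfold Bsum; linarith [abs_nonneg (Skeleton.b2 c' D), abs_nonneg (Skeleton.b3 c' D)]
  have hB2 : |Skeleton.b2 c' D| ≤ Bsum c' D := by
    unfold Bsum; linarith [abs_nonneg (Skeleton.b1 c' D), abs_nonneg (Skeleton.b3 c' D)]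
  have hB3 : |Skeleton.b3 c' D| ≤ Bsum c' D := by
    unfold Bsum; linarith [abs_nonneg (Skeleton.b1 c' D), abs_nonneg (Skeleton.b2 c' D)]
  unfold bJ
  by_cases h1 : j % 3 = 1
  · rw [if_pos h1]
    calc ‖powI (Skeleton.b1 c' D) q + powI (Skeleton.b2 c' D) q + powI (Skeleton.b3 c' D) q - 1 -
          powI (Skeleton.b1 c' D) q‖
        = ‖powI (Skeleton.b2 c' D) q + powI (Skeleton.b3 c' D) q - 1‖ := by ring_nf
      _ ≤ 1 + |Skeleton.b3 c' D| * Real.log q := norm_powI_add_powI_sub_one_le _ _ hq0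
      _ ≤ 1 + Bsum c' D * Real.log q := by gcongr
  · rw [if_neg h1]
    by_cases h2 : j % 3 = 2
    · rw [if_pos h2]
      calc ‖powI (Skeleton.b1 c' D) q + powI (Skeleton.b2 c' D) q + powI (Skeleton.b3 c' D) q - 1 -
            powI (Skeleton.b2 c' D) q‖
          = ‖powI (Skeleton.b1 c' D) q + powI (Skeleton.b3 c' D) q - 1‖ := by ring_nf
        _ ≤ 1 + |Skeleton.b3 c' D| * Real.log q := norm_powI_add_powI_sub_one_le _ _ hq0
        _ ≤ 1 + Bsum c' D * Real.log q := by gcongr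
    · rw [if_neg h2]
      calc ‖powI (Skeleton.b1 c' D) q + powI (Skeleton.b2 c' D) q + powI (Skeleton.b3 c' D) q - 1 -
            powI (Skeleton.b3 c' D) q‖
          = ‖powI (Skeleton.b1 c' D) q + powI (Skeleton.b2 c' D) q - 1‖ := by ring_nf
        _ ≤ 1 + |Skeleton.b2 c' D| * Real.log q := norm_powI_add_powI_sub_one_le _ _ hq0
        _ ≤ 1 + Bsum c' D * Real.log q := by gcongr

/-- `‖q^{−β_j} − q^{1−β_j}/(q−1)‖ = 1/(q−1) ≤ 2/q` for a prime `q` (`q^{1−β_j} = q·q^{−β_j}`,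
`|q^{−β_j}| = 1`). [cite: Zhang2022LandauSiegel, App. A p. 102] -/
theorem norm_cpow_sub_cpow_div_le {q : ℕ} (hq : q.Prime) :
    ‖(q : ℂ) ^ (-Skeleton.betaJ c' D j) -
        (q : ℂ) ^ (1 - Skeleton.betaJ c' D j) / ((q : ℂ) - 1)‖ ≤ 2 / q := by
  have hq2 : (2 : ℝ) ≤ q := by exact_mod_cast hq.two_le
  have hq0 : (q : ℂ) ≠ 0 := by exact_mod_cast hq.ne_zero
  have hq1 : (q : ℂ) - 1 ≠ 0 := by
    intro h
    have : (q : ℂ) = 1 := by linear_combination h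
    have : (q : ℕ) = 1 := by exact_mod_cast this
    exact hq.one_lt.ne' this
  have hu : ‖(q : ℂ) ^ (-Skeleton.betaJ c' D j)‖ = 1 := by
    rw [betaJ_eq, ← powI_apply_of_ne_zero _ hq.ne_zero]
    exact norm_powI_of_pos _ hq.pos
  have hsplit : (q : ℂ) ^ (1 - Skeleton.betaJ c' D j) = (q : ℂ) * (q : ℂ) ^ (-Skeleton.betaJ c' D j) := by
    rw [sub_eq_add_neg, Complex.cpow_add _ _ hq0, Complex.cpow_one]
  have hid : (q : ℂ) ^ (-Skeleton.betaJ c' D j) -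
      (q : ℂ) ^ (1 - Skeleton.betaJ c' D j) / ((q : ℂ) - 1) =
      (q : ℂ) ^ (-Skeleton.betaJ c' D j) * (-(1 / ((q : ℂ) - 1))) := by
    rw [hsplit]
    field_simp
    ring
  rw [hid, norm_mul, hu, one_mul, norm_neg, norm_div, norm_one]
  have hn : ‖(q : ℂ) - 1‖ = (q : ℝ) - 1 := by
    rw [show (q : ℂ) - 1 = (((q : ℝ) - 1 : ℝ) : ℂ) by push_cast; ring, Complex.norm_real,
      Real.norm_eq_abs, abs_of_nonneg (by linarith)]
  rw [hn, div_le_div_iff₀ (by linarith) (by linarith)]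
  linarith

/-- **The tail of the local series of `κ̃₀ⱼ` at a prime** (Case 1, `q ∤ dr`):
`‖Σ_{i≥0} κ(q^{1+i})(q^i)^{−(1−β_j)} − κ(q)‖ ≤ 27·S₃/q`, `S₃ = LogEulerProduct.tailConst 3`
(`‖κ(q^{2+i})‖ ≤ 27(i+1)³`, `q^{i+1} ≥ q·2^i`). [cite: Zhang2022LandauSiegel, App. A p. 102] -/
theorem norm_kappaTildeZero_series_sub_le {q : ℕ} (hq : q.Prime) :
    ‖(∑' i : ℕ, Skeleton.kappaZ c' D (q ^ (1 + i)) /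
          ((q ^ i : ℕ) : ℂ) ^ (1 - Skeleton.betaJ c' D j)) - Skeleton.kappaZ c' D q‖ ≤
      27 * LogEulerProduct.tailConst 3 / q := by
  set s : ℂ := 1 - Skeleton.betaJ c' D j with hs
  have hsre : s.re = 1 := by rw [hs]; exact one_sub_betaJ_re c' D j
  have hq2 : (2 : ℝ) ≤ q := by exact_mod_cast hq.two_le
  have hq0 : (0 : ℝ) < q := by linarith
  set g : ℕ → ℂ := fun i => Skeleton.kappaZ c' D (q ^ (1 + i)) / ((q ^ i : ℕ) : ℂ) ^ s with hg
  -- the norms of the terms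
  have hnorm : ∀ i : ℕ, ‖g i‖ = ‖Skeleton.kappaZ c' D (q ^ (1 + i))‖ / (q : ℝ) ^ i := by
    intro i
    have hpos : 0 < q ^ i := pow_pos hq.pos i
    rw [hg, norm_div, Complex.norm_natCast_cpow_of_pos hpos, hsre, Real.rpow_one, Nat.cast_pow]
  have hsumm : Summable g := by
    refine Summable.of_norm ?_
    simp_rw [hnorm]
    exact summable_locK c' D hq 1
  -- split off the term `i = 0`
  have hg0 : g 0 = Skeleton.kappaZ c' D q := by
    simp [hg, pow_one]
  rw [hsumm.tsum_eq_zero_add, hg0, add_sub_cancel_left]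
  -- the shifted terms
  have hterm : ∀ i : ℕ, ‖g (i + 1)‖ ≤ (27 * (((i : ℝ) + 3) ^ 3 * (1 / 2 : ℝ) ^ i)) / q := by
    intro i
    rw [hnorm, show 1 + (i + 1) = 2 + i by ring, pow_succ, ← div_div]
    have h1 := locK_term_le c' D hq 2 i
    have h2 : ‖Skeleton.kappaZ c' D (q ^ (2 + i))‖ / (q : ℝ) ^ i ≤
        27 * (((i : ℝ) + 3) ^ 3 * (1 / 2 : ℝ) ^ i) := by
      refine h1.trans ?_
      have h3 : ((i : ℝ) + 1) ^ 3 ≤ ((i : ℝ) + 3) ^ 3 :=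
        pow_le_pow_left₀ (by positivity) (by linarith) 3
      have : (((2 : ℕ) : ℝ) + 1) ^ 3 = 27 := by norm_num
      rw [this]
      exact mul_le_mul_of_nonneg_left (mul_le_mul_of_nonneg_right h3 (by positivity)) (by norm_num)
    exact div_le_div_of_nonneg_right h2 hq0.le
  have hsumm' : Summable (fun i : ℕ => ‖g (i + 1)‖) :=
    (summable_nat_add_iff 1).mpr hsumm.norm
  have hmaj : Summable (fun i : ℕ => (27 * (((i : ℝ) + 3) ^ 3 * (1 / 2 : ℝ) ^ i)) / q) :=
    ((LogEulerProduct.summable_tailConst 3).mul_left 27).div_const _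
  calc ‖∑' i : ℕ, g (i + 1)‖ ≤ ∑' i : ℕ, ‖g (i + 1)‖ := norm_tsum_le_tsum_norm hsumm'
    _ ≤ ∑' i : ℕ, (27 * (((i : ℝ) + 3) ^ 3 * (1 / 2 : ℝ) ^ i)) / q :=
        Summable.tsum_le_tsum hterm hsumm' hmaj
    _ = 27 * LogEulerProduct.tailConst 3 / q := by
        rw [tsum_div_const, tsum_mul_left]; rfl

/-- `‖λ₀ⱼ(q)‖ ≤ 1 + 12/q` at a prime `q` (`XiZeroMajorant.norm_lamZero_le_LamC`, `Λc(q) = 1 + 12/q`).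
[cite: Zhang2022LandauSiegel, §7 p. 33] -/
theorem norm_lamZero_prime_le {q : ℕ} (hq : q.Prime) :
    ‖Skeleton.lamZero c' D j q‖ ≤ 1 + 12 / (q : ℝ) := by
  have h := norm_lamZero_le_LamC c' D hq.ne_zero j
  rwa [LamC_apply hq.ne_zero, hq.primeFactors, Finset.prod_singleton] at h

/-- The absolute constant `M₇ = 189·S₃ + 26` of the sharp prime bound, as a number `≥ 0`.
[cite: Zhang2022LandauSiegel, §7 p. 33] -/
theorem sharpConst_nonneg : 0 ≤ 189 * LogEulerProduct.tailConst 3 + 26 := by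
  have := LogEulerProduct.tailConst_nonneg 3; positivity

/-- **The sharp prime bound.** For every prime `q` and all `d, r` (the junk values at `d = 0` or
`r = 0` obey it too):
`‖ξ₀ⱼ(q;d,r)‖ ≤ 1 + [q ∣ r] + 7·B·log q + (189·S₃ + 26)/q` (`B = XiZeroMajorant.Bsum c′ D`,
`S₃ = LogEulerProduct.tailConst 3`). Case 1 (`q ∤ dr`): `ξ₀ⱼ(q) = λ₀ⱼ(q)·(κ̃₀ⱼ(q;dr) −
q^{1−β_j}/(q−1))` with `κ̃₀ⱼ(q;dr) − q^{1−β_j}/(q−1) = (κ(q) − q^{−β_j}) + (tail) + (q^{−β_j} −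
q^{1−β_j}/(q−1))`, of modulus `≤ 1 + B log q + (27S₃+2)/q`, and `|λ₀ⱼ(q)| ≤ 1 + 12/q`; Case 2
(`q ∣ r`): `ξ₀ⱼ(q) = κ(q)`, `|κ(q)| ≤ 2 + B log q`; Case 3 (`q ∣ d`, `q ∤ r`): `ξ₀ⱼ(q) = κ(q) −
q^{1−β_j}/(q−1)`. [cite: Zhang2022LandauSiegel, §7 p. 33; App. A pp. 102–103] -/
theorem norm_xiZero_prime_le_sharp {d r : ℕ} {q : ℕ} (hq : q.Prime) :
    ‖Skeleton.xiZero c' D j q d r‖ ≤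
      1 + (if q ∣ r then (1 : ℝ) else 0) + 7 * Bsum c' D * Real.log q +
        (189 * LogEulerProduct.tailConst 3 + 26) / q := by
  have hq2 : (2 : ℝ) ≤ q := by exact_mod_cast hq.two_le
  have hq0 : (0 : ℝ) < q := by linarith
  have hlog : 0 ≤ Real.log q := Real.log_nonneg (by linarith)
  have hB : 0 ≤ Bsum c' D := Bsum_nonneg c' D
  have hS : 0 ≤ LogEulerProduct.tailConst 3 := LogEulerProduct.tailConst_nonneg 3
  have hBL : 0 ≤ Bsum c' D * Real.log q := mul_nonneg hB hlog
  have hκq := norm_kappaZ_sub_cpow_le c' D j hq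
  have hcp := norm_cpow_sub_cpow_div_le c' D j hq
  by_cases hqr : q ∣ r
  · -- Case 2
    rw [if_pos hqr, ← pow_one q, Lemma83.xiZero_prime_pow_of_dvd_right c' D j hq one_ne_zero hqr,
      pow_one]
    have h := norm_kappa_prime_le (Skeleton.b1 c' D) (Skeleton.b2 c' D) (Skeleton.b3 c' D) hq
    have hB' : (|Skeleton.b1 c' D| + |Skeleton.b2 c' D| + |Skeleton.b3 c' D|) = Bsum c' D := rfl
    rw [hB'] at h
    have hM : 0 ≤ (189 * LogEulerProduct.tailConst 3 + 26) / (q : ℝ) := by positivity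
    calc ‖Skeleton.kappaZ c' D q‖ ≤ 2 + Bsum c' D * Real.log q := h
      _ ≤ 1 + 1 + 7 * Bsum c' D * Real.log q + (189 * LogEulerProduct.tailConst 3 + 26) / q := by
          nlinarith
  rw [if_neg hqr, add_zero]
  by_cases hqd : q ∣ d
  · -- Case 3
    rw [← pow_one q, Lemma83.xiZero_prime_pow_of_dvd_left c' D j hq one_ne_zero hqd hqr, pow_one,
      Nat.sub_self, pow_zero, Lemma83.kappaZ_one, one_mul]
    have hsplit : Skeleton.kappaZ c' D q - (q : ℂ) ^ (1 - Skeleton.betaJ c' D j) / ((q : ℂ) - 1) =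
        (Skeleton.kappaZ c' D q - (q : ℂ) ^ (-Skeleton.betaJ c' D j)) +
          ((q : ℂ) ^ (-Skeleton.betaJ c' D j) -
            (q : ℂ) ^ (1 - Skeleton.betaJ c' D j) / ((q : ℂ) - 1)) := by ring
    rw [hsplit]
    calc _ ≤ ‖Skeleton.kappaZ c' D q - (q : ℂ) ^ (-Skeleton.betaJ c' D j)‖ +
          ‖(q : ℂ) ^ (-Skeleton.betaJ c' D j) -
            (q : ℂ) ^ (1 - Skeleton.betaJ c' D j) / ((q : ℂ) - 1)‖ := norm_add_le _ _
      _ ≤ (1 + Bsum c' D * Real.log q) + 2 / q := add_le_add hκq hcp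
      _ ≤ 1 + 7 * Bsum c' D * Real.log q + (189 * LogEulerProduct.tailConst 3 + 26) / q := by
          have h1 : (2 : ℝ) / q ≤ (189 * LogEulerProduct.tailConst 3 + 26) / q :=
            div_le_div_of_nonneg_right (by linarith) hq0.le
          linarith
  · -- Case 1
    rw [← pow_one q, Lemma83.xiZero_prime_pow_of_coprime c' D j hq one_ne_zero hqd hqr, pow_one,
      Nat.sub_self, pow_zero, Lemma83.kappaZ_one, one_mul, norm_mul]
    set T : ℂ := ∑' i : ℕ, Skeleton.kappaZ c' D (q ^ (1 + i)) /
      ((q ^ i : ℕ) : ℂ) ^ (1 - Skeleton.betaJ c' D j) with hT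
    have htail := norm_kappaTildeZero_series_sub_le c' D j hq
    have hsplit : T - (q : ℂ) ^ (1 - Skeleton.betaJ c' D j) / ((q : ℂ) - 1) =
        (T - Skeleton.kappaZ c' D q) +
          (Skeleton.kappaZ c' D q - (q : ℂ) ^ (-Skeleton.betaJ c' D j)) +
          ((q : ℂ) ^ (-Skeleton.betaJ c' D j) -
            (q : ℂ) ^ (1 - Skeleton.betaJ c' D j) / ((q : ℂ) - 1)) := by ring
    have hinner : ‖T - (q : ℂ) ^ (1 - Skeleton.betaJ c' D j) / ((q : ℂ) - 1)‖ ≤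
        1 + Bsum c' D * Real.log q + (27 * LogEulerProduct.tailConst 3 + 2) / q := by
      rw [hsplit]
      calc _ ≤ ‖T - Skeleton.kappaZ c' D q‖ +
            ‖Skeleton.kappaZ c' D q - (q : ℂ) ^ (-Skeleton.betaJ c' D j)‖ +
            ‖(q : ℂ) ^ (-Skeleton.betaJ c' D j) -
              (q : ℂ) ^ (1 - Skeleton.betaJ c' D j) / ((q : ℂ) - 1)‖ := norm_add₃_le
        _ ≤ 27 * LogEulerProduct.tailConst 3 / q + (1 + Bsum c' D * Real.log q) + 2 / q :=
            add_le_add (add_le_add htail hκq) hcp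
        _ = 1 + Bsum c' D * Real.log q + (27 * LogEulerProduct.tailConst 3 + 2) / q := by ring
    have hlam := norm_lamZero_prime_le c' D j hq
    set BL : ℝ := Bsum c' D * Real.log q with hBLdef
    set M₁ : ℝ := 27 * LogEulerProduct.tailConst 3 + 2 with hM₁
    have hM₁0 : 0 ≤ M₁ := by rw [hM₁]; positivity
    have hin0 : 0 ≤ 1 + BL + M₁ / q := by positivity
    calc ‖Skeleton.lamZero c' D j q‖ * ‖T - (q : ℂ) ^ (1 - Skeleton.betaJ c' D j) / ((q : ℂ) - 1)‖
        ≤ (1 + 12 / (q : ℝ)) * (1 + BL + M₁ / q) :=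
          mul_le_mul hlam hinner (norm_nonneg _) (by positivity)
      _ ≤ 1 + 7 * BL + (189 * LogEulerProduct.tailConst 3 + 26) / q := by
          -- `(1+12/q)(1+BL+M₁/q) = 1 + BL + (12 + 12BL + M₁ + 12M₁/q)/q` and `12/q ≤ 6`
          have h12 : 12 / (q : ℝ) ≤ 6 := by
            rw [div_le_iff₀ hq0]; linarith
          have hexp : (1 + 12 / (q : ℝ)) * (1 + BL + M₁ / q) =
              1 + BL + 12 / q * BL + (12 + M₁ + 12 / q * M₁) / q := by
            field_simp
            ring
          rw [hexp]
          have h1 : 12 / (q : ℝ) * BL ≤ 6 * BL := mul_le_mul_of_nonneg_right h12 hBL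
          have h2 : (12 + M₁ + 12 / (q : ℝ) * M₁) / q ≤ (189 * LogEulerProduct.tailConst 3 + 26) / q := by
            refine div_le_div_of_nonneg_right ?_ hq0.le
            have : 12 / (q : ℝ) * M₁ ≤ 6 * M₁ := mul_le_mul_of_nonneg_right h12 hM₁0
            rw [hM₁] at this ⊢
            linarith
          linarith
      _ = 1 + 7 * Bsum c' D * Real.log q + (189 * LogEulerProduct.tailConst 3 + 26) / q := by
          rw [hBLdef]; ring

/-! ### Part 3. The engine: short-interval absolute mean of `ξ₀ⱼ` -/

/-- **Short-interval absolute mean of `ξ₀ⱼ(·;d,r)`, no logarithmic loss.** There are absolute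
`C ≥ 0`, `x₀ ≥ 2` such that for all `c′, D, j`, all `d, r ≥ 1`, all `x ≥ x₀` and
`x^{1/4} ≤ y ≤ x`:
`Σ_{x<n≤x+y} ‖ξ₀ⱼ(n;d,r)‖ ≤ C · e^{7B·log(4x)} · (r/φ(r)) · y` (`B = XiZeroMajorant.Bsum c′ D`).
Shiu's theorem (`shiu_divisor_class_dvd` at `a = 1`, `d = 3`, `C₅ = 1806`) for the multiplicative
`n ↦ ‖ξ₀ⱼ(n;d,r)‖` (`Lemma83.xiZero_mul_of_coprime`, `norm_xiZero_prime_pow_le`) with the sharp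
prime bound `norm_xiZero_prime_le_sharp`. [cite: Zhang2022LandauSiegel, §7 p. 33]
[cite: Shiu1980, Theorem 1] -/
theorem xiZero_shortInterval :
    ∃ C x₀ : ℝ, 0 ≤ C ∧ 2 ≤ x₀ ∧ ∀ (c' : ℝ) (D j : ℕ) (d r : ℕ), d ≠ 0 → r ≠ 0 →
      ∀ x y : ℝ, x₀ ≤ x → x ^ (1 / 4 : ℝ) ≤ y → y ≤ x →
        ∑ n ∈ (Finset.Icc 1 ⌊x + y⌋₊).filter (fun n : ℕ => x < n),
            ‖Skeleton.xiZero c' D j n d r‖ ≤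
          C * Real.exp (7 * Bsum c' D * Real.log (4 * x)) * ((r : ℝ) / r.totient) * y := by
  obtain ⟨C, x₀, hC0, hx₀, h⟩ := shiu_divisor_class_dvd 1 3 1806
  refine ⟨C * Real.exp (189 * LogEulerProduct.tailConst 3 + 26), x₀, by positivity, hx₀, ?_⟩
  intro c' D j d r hd hr x y hx hxy hyx
  have hx2 : 2 ≤ x := le_trans hx₀ hx
  have hx1 : 1 < x := by linarith
  have hlogx : 0 < Real.log x := Real.log_pos hx1
  set f : ℕ → ℝ := fun n => ‖Skeleton.xiZero c' D j n d r‖ with hf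
  have hf0 : ∀ n, 0 ≤ f n := fun n => norm_nonneg _
  have hmul : ∀ m n : ℕ, m.Coprime n → f (m * n) = f m * f n := by
    intro m n hmn
    simp only [hf]
    rw [Lemma83.xiZero_mul_of_coprime c' D j hd hr hmn, norm_mul]
  have hpow : ∀ p ν : ℕ, p.Prime → 1 ≤ ν → f (p ^ ν) ≤ 1806 * ((ν : ℝ) + 1) ^ 3 :=
    fun p ν hp hν => Lemma83.norm_xiZero_prime_pow_le c' D j hp (Nat.one_le_iff_ne_zero.mp hν) d r
  have hK : 0 ≤ 7 * Bsum c' D := mul_nonneg (by norm_num) (Bsum_nonneg c' D)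
  have hfp : ∀ p : ℕ, p.Prime → (p : ℝ) ≤ x →
      f p ≤ (1 : ℕ) + (if p ∣ r then (1 : ℝ) else 0) + 7 * Bsum c' D * Real.log p +
        (189 * LogEulerProduct.tailConst 3 + 26) / p := by
    intro p hp _
    rw [Nat.cast_one]
    exact norm_xiZero_prime_le_sharp c' D j hp
  have key := h f hf0 hmul hpow r hr (7 * Bsum c' D) (189 * LogEulerProduct.tailConst 3 + 26) hK
    sharpConst_nonneg x y hx hxy hyx hfp
  refine key.trans (le_of_eq ?_)
  rw [pow_one, Real.exp_add]
  field_simp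

/-- The engine over `Finset.Ioc ⌊x⌋₊ ⌊x+y⌋₊` (the block `{n : x < n ≤ x + y}` for `x ≥ 0`), in the
shape consumed by `GaussWeight.norm_sum_Ico_sub_tsum_mul_gWeight_le_of_shortInterval` (`√x ≤ y`).
[cite: Zhang2022LandauSiegel, §7 p. 33] [cite: Shiu1980, Theorem 1] -/
theorem xiZero_shortInterval_Ioc :
    ∃ C x₀ : ℝ, 0 ≤ C ∧ 2 ≤ x₀ ∧ ∀ (c' : ℝ) (D j : ℕ) (d r : ℕ), d ≠ 0 → r ≠ 0 →
      ∀ x y : ℝ, x₀ ≤ x → Real.sqrt x ≤ y → y ≤ x →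
        ∑ n ∈ Finset.Ioc ⌊x⌋₊ ⌊x + y⌋₊, ‖Skeleton.xiZero c' D j n d r‖ ≤
          C * Real.exp (7 * Bsum c' D * Real.log (4 * x)) * ((r : ℝ) / r.totient) * y := by
  obtain ⟨C, x₀, hC0, hx₀, h⟩ := xiZero_shortInterval
  refine ⟨C, x₀, hC0, hx₀, ?_⟩
  intro c' D j d r hd hr x y hx hy hyx
  have hx2 : 2 ≤ x := le_trans hx₀ hx
  have hx0 : 0 ≤ x := by linarith
  have hset : (Finset.Icc 1 ⌊x + y⌋₊).filter (fun n : ℕ => x < n) = Finset.Ioc ⌊x⌋₊ ⌊x + y⌋₊ := by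
    ext n
    simp only [Finset.mem_filter, Finset.mem_Icc, Finset.mem_Ioc]
    constructor
    · rintro ⟨⟨-, h2⟩, h3⟩
      exact ⟨(Nat.floor_lt hx0).mpr h3, h2⟩
    · rintro ⟨h1, h2⟩
      exact ⟨⟨by omega, h2⟩, (Nat.floor_lt hx0).mp h1⟩
  have hy' : x ^ (1 / 4 : ℝ) ≤ y := by
    refine le_trans ?_ hy
    rw [Real.sqrt_eq_rpow x]
    exact Real.rpow_le_rpow_of_exponent_le (by linarith) (by norm_num)
  rw [← hset]
  exact h c' D j d r hd hr x y hx hy' hyx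

end Literature.NumberTheory.LFunctions.Zhang2022.XiZeroMajorant

end
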